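import Summits.NavierStokesRegularity.NavierStokesRegularity.Theses.SymmetryModuliCount
import Literature.Analysis.FluidPDE.TypeIAncientMild

/-!
# Sketch — crux `ForcedSymmetry` (stmt-NavierStokesRegularity-4052), ideator 2, round 1

Two idea cards are supported by this file (every `First lemma:` elaborates here):

* `time-anchor-bootstrap` — the crux's similarity algebra anchors scalings at `t = 0`, while the
  class `A_C` is invariant under BACKWARD time shifts `u ↦ u(· + θ)`, `θ < 0`
  (`IsTypeIAncientMild.comp_sub_right`). Applying `ForcedSymmetry` to `u` and to a shift and
  subtracting the two (normalised) generators produces `τ ∂ₜ + Killing` with `τ ≠ 0`, which Type-I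
  decay at `t = -∞` kills (`RigidComotionVanishesOnEnd`); the remaining case is a Killing symmetry.
  Machine-checked here: `forcedSymmetry_implies_liouville` — ForcedSymmetry ⇒ X
  (= `TypeIAncientLiouville`, the route TARGET) modulo three named analytic inputs, none of which
  involves a scaling symmetry; and the trivial converse `liouville_implies_forcedSymmetry`.
* `helical-lattice-collapse` — a screw group of nonzero pitch contains the translation by one
  pitch, so the helical leaf IS the periodic leaf; with `PeriodicEndLiouville` (sibling card
  backward-profile-symmetrisation on crux 4054: zoom-out collapses the period, then the tree
  theorem `KNSS2009_typeI_rate_liouville_holds`) and the axisymmetric leaf this gives the Killing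
  leaf `KillingEndLiouville` used above. Machine-checked glue: `killingEndLiouville_of_leaves`.

Everything analytic is a named `Prop` hypothesis; everything proved here is algebra/logic.
-/

noncomputable section

set_option linter.dupNamespace false

namespace Summit.NavierStokesRegularity.NavierStokesRegularity.Cruxes.ForcedSymmetry.Ideator2

open Literature.Analysis.FluidPDE MeasureTheory Set Function
open scoped RealInnerProductSpace

open Summit.NavierStokesRegularity.NavierStokesRegularity.Theses.SymmetryModuliCount
  (ForcedSymmetry TypeIAncientLiouville SymmetricLiouville)

/-- `ℝ³` as in the route file. -/
abbrev E3 : Type := EuclideanSpace ℝ (Fin 3)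

/-! ## The class and the extended generator -/

/-- The class `A_C`, literally as the route writes it (= `IsTypeIAncientMild C u`, see
`inClassA_iff`). -/
def InClassA (C : ℝ) (u : ℝ → E3 → E3) : Prop :=
  ContDiffOn ℝ (⊤ : ℕ∞) (Function.uncurry u) (Set.Iio 0 ×ˢ Set.univ) ∧
    (∀ t < 0, VectorCalculus.IsDivFree (u t)) ∧
    (∀ s t : ℝ, s < t → t < 0 → ∀ x, u t x = heatFlow (u s) (t - s) x -
      ∫ τ in Set.Ioo s t, ∫ y, oseenKernel (t - τ) (x - y) (u τ y) (u τ y)) ∧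
    HasTypeITimeDecay C u

theorem inClassA_iff {C : ℝ} {u : ℝ → E3 → E3} : InClassA C u ↔ IsTypeIAncientMild C u :=
  (isTypeIAncientMild_iff (C := C) (u := u)).symm

/-- Skewness as the route writes it. -/
def IsSkew (A : E3 →L[ℝ] E3) : Prop := ∀ x, ⟪A x, x⟫ = 0

/-- The EXTENDED infinitesimal generator `(a, σ, A, τ) ∈ ⟨∂ₜ⟩ ⊕ sim(3)` acting on `u`:
`L u = ∇u·(a + σx + Ax) + σu + (2σt + τ)∂ₜu − Au`. The crux's `L_ξ` is `τ = 0` (scalings anchored at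
`t = 0`); a scaling anchored at time `θ` has `τ = -2σθ`; `σ = 0, τ ≠ 0` is "time translation +
Killing" (rigid co-motion: rotating / travelling waves, steady states). -/
def extGen (u : ℝ → E3 → E3) (a : E3) (σ : ℝ) (A : E3 →L[ℝ] E3) (τ : ℝ) (t : ℝ) (x : E3) : E3 :=
  fderiv ℝ (u t) x (a + σ • x + A x) + σ • u t x + (2 * σ * t + τ) • timeDeriv u t x - A (u t x)

theorem extGen_tau_zero (u : ℝ → E3 → E3) (a : E3) (σ : ℝ) (A : E3 →L[ℝ] E3) (t : ℝ) (x : E3) :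
    extGen u a σ A 0 t x =
      fderiv ℝ (u t) x (a + σ • x + A x) + σ • u t x + (2 * σ * t) • timeDeriv u t x - A (u t x) := by
  simp [extGen]

/-- `ForcedSymmetry`, unbundled (definitional repackaging). -/
theorem forcedSymmetry_iff :
    ForcedSymmetry ↔ ∀ (C : ℝ) (u : ℝ → E3 → E3), InClassA C u →
      ∃ (a : E3) (σ : ℝ) (A : E3 →L[ℝ] E3), IsSkew A ∧ ¬ (a = 0 ∧ σ = 0 ∧ A = 0) ∧
        ∀ t < 0, ∀ x, extGen u a σ A 0 t x = 0 := by
  simp only [extGen_tau_zero]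
  rfl

/-- `TypeIAncientLiouville` (route target X), unbundled. -/
theorem typeIAncientLiouville_iff :
    TypeIAncientLiouville ↔ ∀ (C : ℝ) (u : ℝ → E3 → E3), InClassA C u → ∀ t < 0, ∀ x, u t x = 0 :=
  Iff.rfl

/-! ## Algebra of the extended generator (proved) -/

/-- **Transport of an anchored symmetry along a backward time shift.** If the shifted field
`u_θ(t) = u(t + θ)` is annihilated by `(a, σ, A, 0)` on `t < 0`, then `u` is annihilated by
`(a, σ, A, -2σθ)` on `t < θ` — a similarity anchored at time `θ`. Pure calculus
(`deriv_comp_add_const`). -/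
theorem extGen_transport {u : ℝ → E3 → E3} {a : E3} {σ : ℝ} {A : E3 →L[ℝ] E3} {θ : ℝ}
    (h : ∀ t < 0, ∀ x, extGen (fun t x => u (t + θ) x) a σ A 0 t x = 0) :
    ∀ t < θ, ∀ x, extGen u a σ A (-2 * σ * θ) t x = 0 := by
  intro t ht x
  have key := h (t - θ) (by linarith) x
  simp only [extGen, timeDeriv_apply] at key ⊢
  have hd : deriv (fun s => u (s + θ) x) (t - θ) = deriv (fun s => u s x) t := by
    have e := deriv_comp_add_const (f := fun s => u s x) (a := θ) (x := t - θ)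
    simp only [sub_add_cancel] at e
    exact e
  rw [hd] at key
  have ht' : t - θ + θ = t := by ring
  simp only [ht'] at key
  have hc : (2 * σ * (t - θ) + 0) = (2 * σ * t + -2 * σ * θ) := by ring
  rw [hc] at key
  exact key

/-- **Subtraction of two anchored generators.** From `(a₀, σ₀, A₀, 0)` and `(a₁, σ₁, A₁, τ₁)` both
annihilating `u` on `t < θ` one gets the Killing-plus-time-translation generator
`(σ₁a₀ − σ₀a₁, 0, σ₁A₀ − σ₀A₁, −σ₀τ₁)`. Linearity of `ξ ↦ L_ξ u`. -/
theorem extGen_combine {u : ℝ → E3 → E3} {a₀ a₁ : E3} {σ₀ σ₁ τ₁ θ : ℝ} {A₀ A₁ : E3 →L[ℝ] E3}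
    (h₀ : ∀ t < θ, ∀ x, extGen u a₀ σ₀ A₀ 0 t x = 0)
    (h₁ : ∀ t < θ, ∀ x, extGen u a₁ σ₁ A₁ τ₁ t x = 0) :
    ∀ t < θ, ∀ x, extGen u (σ₁ • a₀ - σ₀ • a₁) 0 (σ₁ • A₀ - σ₀ • A₁) (-(σ₀ * τ₁)) t x = 0 := by
  intro t ht x
  have k₀ := h₀ t ht x
  have k₁ := h₁ t ht x
  simp only [extGen, map_add, map_smul, ContinuousLinearMap.coe_sub', ContinuousLinearMap.coe_smul', Pi.sub_apply,
    Pi.smul_apply, map_sub] at k₀ k₁ ⊢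
  linear_combination (norm := module) σ₁ • k₀ - σ₀ • k₁

theorem isSkew_combine {σ₀ σ₁ : ℝ} {A₀ A₁ : E3 →L[ℝ] E3} (h₀ : IsSkew A₀) (h₁ : IsSkew A₁) :
    IsSkew (σ₁ • A₀ - σ₀ • A₁) := by
  intro x
  simp [inner_sub_left, inner_smul_left, h₀ x, h₁ x]

/-! ## The three analytic inputs of the collapse (named; NOT proved here) -/

/-- **Rigid co-motion is fatal** (elementary): if `u ∈ A_C` is annihilated on a backward end
`t < θ` by `τ∂ₜ + (a + Ax)·∇ − A` with `τ ≠ 0` and `A` skew, then `u ≡ 0` on that end. Proof: the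
symmetry integrates to `u(t + τs) = (rigid screw motion)_s · u(t)`, so `t ↦ ‖u(t)‖_∞` is constant on
the end, and `‖u(t)‖_∞ ≤ C/√(−t) → 0` at `−∞`. (Pineau–Vicol arXiv:2607.09619 Rem. 1.8: the
Killing solitons of NS; here they die by the Type-I rate alone.) Size S–M. -/
def RigidComotionVanishesOnEnd : Prop :=
  ∀ (C : ℝ) (u : ℝ → E3 → E3), IsTypeIAncientMild C u →
    ∀ (a : E3) (A : E3 →L[ℝ] E3) (τ θ : ℝ), IsSkew A → τ ≠ 0 → θ ≤ 0 →
      (∀ t < θ, ∀ x, extGen u a 0 A τ t x = 0) → ∀ t < θ, ∀ x, u t x = 0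

/-- **Killing leaf on a backward end**: a nonzero Killing generator `(a, 0, A, 0)` (translation,
screw = helical, or rotation about a shifted axis) annihilating `u ∈ A_C` on `t < θ` forces `u ≡ 0`
there. Reduced below (`killingEndLiouville_of_leaves`) to the periodic leaf + the axisymmetric leaf.
No scaling symmetry, no Tsai, no rotated-self-similar Liouville enters. -/
def KillingEndLiouville : Prop :=
  ∀ (C : ℝ) (u : ℝ → E3 → E3), IsTypeIAncientMild C u →
    ∀ (a : E3) (A : E3 →L[ℝ] E3) (θ : ℝ), IsSkew A → ¬ (a = 0 ∧ A = 0) → θ ≤ 0 →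
      (∀ t < θ, ∀ x, extGen u a 0 A 0 t x = 0) → ∀ t < θ, ∀ x, u t x = 0

/-- **Vanishing on a backward end propagates forward** (forward uniqueness of bounded mild
solutions of the Oseen equation from zero data; singular Gronwall on `[θ, t'] ⊂ (−∞, 0)`, where the
field is bounded by `C/√(−t')`). Known/folklore, size S–M. -/
def BackwardEndVanishing : Prop :=
  ∀ (C : ℝ) (u : ℝ → E3 → E3), IsTypeIAncientMild C u → ∀ θ ≤ (0 : ℝ),
    (∀ t < θ, ∀ x, u t x = 0) → ∀ t < 0, ∀ x, u t x = 0

/-! ## The collapse: ForcedSymmetry ⇒ X (proved modulo the three inputs) -/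

/-- **TIME-ANCHOR BOOTSTRAP.** `ForcedSymmetry → TypeIAncientLiouville`, given the three inputs.
Proof: fix `u ∈ A_C`; the shift `u₋₁(t) = u(t − 1)` is in `A_C` (`IsTypeIAncientMild.comp_sub_right`);
ForcedSymmetry gives generators `ξ₀` for `u` (anchored at `t = 0`) and `ξ₁` for `u₋₁`, transported
to a generator of `u` anchored at `t = −1` (`extGen_transport`). If `σ₀ = 0` or `σ₁ = 0`, `u` has a
Killing symmetry on `t < −1` → `KillingEndLiouville`. Otherwise `extGen_combine` produces
`τ∂ₜ + Killing` with `τ = −2σ₀σ₁ ≠ 0` → `RigidComotionVanishesOnEnd`. Either way `u ≡ 0` on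
`t < −1`, and `BackwardEndVanishing` finishes. -/
theorem forcedSymmetry_implies_liouville (hR : RigidComotionVanishesOnEnd)
    (hK : KillingEndLiouville) (hB : BackwardEndVanishing) :
    ForcedSymmetry → TypeIAncientLiouville := by
  rw [forcedSymmetry_iff, typeIAncientLiouville_iff]
  intro hF C u hu
  have hu' : IsTypeIAncientMild C u := inClassA_iff.1 hu
  -- the backward shift by 1
  have hshift : IsTypeIAncientMild C (fun t x => u (t + (-1)) x) := by
    have := hu'.comp_sub_right (δ := 1) zero_le_one
    simpa [sub_eq_add_neg] using this
  obtain ⟨a₀, σ₀, A₀, hA₀, hne₀, h₀⟩ := hF C u hu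
  obtain ⟨a₁, σ₁, A₁, hA₁, hne₁, h₁⟩ := hF C _ (inClassA_iff.2 hshift)
  have h₁' : ∀ t < (-1 : ℝ), ∀ x, extGen u a₁ σ₁ A₁ (-2 * σ₁ * (-1)) t x = 0 := extGen_transport h₁
  -- restrict ξ₀ to the end t < -1
  have h₀' : ∀ t < (-1 : ℝ), ∀ x, extGen u a₀ σ₀ A₀ 0 t x = 0 :=
    fun t ht x => h₀ t (by linarith) x
  apply hB C u hu' (-1) (by norm_num)
  by_cases hσ₀ : σ₀ = 0
  · subst hσ₀
    have hne : ¬ (a₀ = 0 ∧ A₀ = 0) := fun h => hne₀ ⟨h.1, rfl, h.2⟩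
    exact hK C u hu' a₀ A₀ (-1) hA₀ hne (by norm_num) h₀'
  by_cases hσ₁ : σ₁ = 0
  · subst hσ₁
    have hne : ¬ (a₁ = 0 ∧ A₁ = 0) := fun h => hne₁ ⟨h.1, rfl, h.2⟩
    have h₁'' : ∀ t < (-1 : ℝ), ∀ x, extGen u a₁ 0 A₁ 0 t x = 0 := by
      intro t ht x; have := h₁' t ht x; simpa using this
    exact hK C u hu' a₁ A₁ (-1) hA₁ hne (by norm_num) h₁''
  -- both scaling rates nonzero: subtract the two anchored generators
  have hcomb := extGen_combine (θ := -1) h₀' h₁'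
  have hτ : -(σ₀ * (-2 * σ₁ * (-1))) ≠ 0 := by
    have : σ₀ * σ₁ ≠ 0 := mul_ne_zero hσ₀ hσ₁
    intro h; apply this; linarith
  exact hR C u hu' _ _ _ (-1) (isSkew_combine hA₀ hA₁) hτ (by norm_num) hcomb

/-- The trivial converse: X ⇒ ForcedSymmetry (the zero field is annihilated by a translation). -/
theorem liouville_implies_forcedSymmetry : TypeIAncientLiouville → ForcedSymmetry := by
  rw [forcedSymmetry_iff, typeIAncientLiouville_iff]
  intro hX C u hu
  have h0 : ∀ t < 0, ∀ x, u t x = 0 := hX C u hu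
  refine ⟨EuclideanSpace.single 0 1, 0, 0, fun x => by simp, ?_, ?_⟩
  · rintro ⟨h, -, -⟩
    have := congrArg (fun v : E3 => v 0) h
    simp at this
  · intro t ht x
    have hut : u t = fun _ => 0 := funext (h0 t ht)
    simp [extGen, hut]

/-- Hence, given the three inputs, the crux is EQUIVALENT to the route target. -/
theorem forcedSymmetry_iff_liouville (hR : RigidComotionVanishesOnEnd)
    (hK : KillingEndLiouville) (hB : BackwardEndVanishing) :
    ForcedSymmetry ↔ TypeIAncientLiouville :=
  ⟨forcedSymmetry_implies_liouville hR hK hB, liouville_implies_forcedSymmetry⟩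

/-- And the sibling crux becomes redundant in the assembly: ForcedSymmetry alone gives
`SymmetricLiouville` (in particular its OPEN rotated-self-similar bounded-profile leaf). -/
theorem forcedSymmetry_implies_symmetricLiouville (hR : RigidComotionVanishesOnEnd)
    (hK : KillingEndLiouville) (hB : BackwardEndVanishing) :
    ForcedSymmetry → SymmetricLiouville := by
  intro hF C u hu a σ A _ _ _
  exact (forcedSymmetry_implies_liouville hR hK hB hF) C u hu

/-! ## Card `helical-lattice-collapse`: the Killing leaf from the periodic and axisymmetric leaves -/

/-- **Helical-or-translation ⇒ lattice** (calculus of the screw flow): if `u` (smooth on the end)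
is annihilated by the Killing generator `(a, 0, A, 0)` on `t < θ` and `a ∉ range A` (i.e. the pitch
is nonzero, or `A = 0` and it is a translation), then `u` is periodic on the end with a nonzero
period `L` (`L = (2π/ρ) a_∥` = one full turn of the screw; `L = a` if `A = 0`). Size S–M. -/
def HelicalOrTranslationIsPeriodic : Prop :=
  ∀ (C : ℝ) (u : ℝ → E3 → E3), IsTypeIAncientMild C u →
    ∀ (a : E3) (A : E3 →L[ℝ] E3) (θ : ℝ), IsSkew A → a ∉ Set.range A → θ ≤ 0 →
      (∀ t < θ, ∀ x, extGen u a 0 A 0 t x = 0) →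
        ∃ L : E3, L ≠ 0 ∧ ∀ t < θ, ∀ x, u t (x + L) = u t x

/-- **Periodic leaf on a backward end** (sibling card backward-profile-symmetrisation, crux 4054,
`PeriodicTypeIAncientLiouville`, here localised to an end): a field of `A_C` periodic in one
direction on `t < θ` vanishes there. Proof: recentred zoom-OUT `μₙu(μₙ²t, xₙ + μₙx)`, `μₙ → ∞`,
collapses the period `L/μₙ → 0`, the limit is invariant under all translations along `L`, hence 0
by the tree theorem `KNSS2009_typeI_rate_liouville_holds`; so the backward amplitude
`sup √(−t)|u| → 0` and the Kato/KNSS gap gives `u ≡ 0`. Size M. -/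
def PeriodicEndLiouville : Prop :=
  ∀ (C : ℝ) (u : ℝ → E3 → E3), IsTypeIAncientMild C u → ∀ (L : E3) (θ : ℝ), L ≠ 0 → θ ≤ 0 →
    (∀ t < θ, ∀ x, u t (x + L) = u t x) → ∀ t < θ, ∀ x, u t x = 0

/-- **Axisymmetric leaf on a backward end** (KNSS 2009 Thms 5.2–5.3 with Seregin–Šverák 2009
Prop. 3.7 / Thm 3.1; tree: `AxisymmetricTypeIExclusion_holds`, `KNSS2009_liouville_bound_C_over_r_holds`,
`KNSS2009_typeI_rate_rMulNorm_bounded_holds`): `u ∈ A_C` invariant under the rotations generated by a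
nonzero skew `A` about the axis through `c` (`∇u·A(x − c) = Au`) on `t < θ` vanishes there.
Known in print; the transfer to the KNSS-mild ancient class is size M. -/
def AxisymEndLiouville : Prop :=
  ∀ (C : ℝ) (u : ℝ → E3 → E3), IsTypeIAncientMild C u →
    ∀ (c : E3) (A : E3 →L[ℝ] E3) (θ : ℝ), IsSkew A → A ≠ 0 → θ ≤ 0 →
      (∀ t < θ, ∀ x, extGen u (-(A c)) 0 A 0 t x = 0) → ∀ t < θ, ∀ x, u t x = 0

/-- **The Killing leaf is the periodic leaf plus the axisymmetric leaf** (glue, proved): split on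
`a ∈ range A`. If `a = A c'`, the generator is the rotation about the axis through `−c'`
(and `A ≠ 0`, else `(a, A) = 0`); otherwise the screw has nonzero pitch (or is a translation) and
`u` is periodic. In particular the HELICAL leaf, listed OPEN in the sibling Disproof of
`SymmetricLiouville`, is closed by `PeriodicEndLiouville`. -/
theorem killingEndLiouville_of_leaves (hH : HelicalOrTranslationIsPeriodic)
    (hP : PeriodicEndLiouville) (hA : AxisymEndLiouville) : KillingEndLiouville := by
  intro C u hu a A θ hAs hne hθ hsym
  by_cases hr : a ∈ Set.range A
  · obtain ⟨c', hc'⟩ := hr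
    have hA0 : A ≠ 0 := by
      rintro rfl
      apply hne
      refine ⟨?_, rfl⟩
      rw [← hc']; simp
    refine hA C u hu (-c') A θ hAs hA0 hθ ?_
    intro t ht x
    have := hsym t ht x
    simpa [extGen, hc', map_neg] using this
  · obtain ⟨L, hL, hper⟩ := hH C u hu a A θ hAs hr hθ hsym
    exact hP C u hu L θ hL hθ hper

/-- Net statement of the two cards together: ForcedSymmetry ⇔ X given FIVE named inputs, every one
of which is either known in print (axisymmetric leaf, forward uniqueness), elementary (rigid
co-motion, screw calculus) or the sibling card's M-sized theorem (periodic leaf); NO rotated- or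
discretely-self-similar Liouville statement is among them. -/
theorem forcedSymmetry_iff_liouville' (hR : RigidComotionVanishesOnEnd)
    (hH : HelicalOrTranslationIsPeriodic) (hP : PeriodicEndLiouville) (hA : AxisymEndLiouville)
    (hB : BackwardEndVanishing) : ForcedSymmetry ↔ TypeIAncientLiouville :=
  forcedSymmetry_iff_liouville hR (killingEndLiouville_of_leaves hH hP hA) hB

end Summit.NavierStokesRegularity.NavierStokesRegularity.Cruxes.ForcedSymmetry.Ideator2

end
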